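import Mathlib
import HarnessLib

/-!
# An `L¹`-bounded linear functional has an essentially bounded density (`(L¹)* ⊂ L^∞`, finite measure)

Topic `MeasureTheory/Function`; namespace `Literature.MeasureTheory.Function`.  THEOREMS ONLY: everything is PROVED; no definition,
no named fact, no axiom; no instances, no notation.

THEOREM (`exists_bounded_density_of_l1_bounded`).  Let `μ` be a finite measure on `α` and `W : L¹(μ;ℝ) →L[ℝ] ℝ` a continuous linear
functional with `|W f| ≤ B‖f‖₁` for all `f`.  Then there is an integrable `g : α → ℝ` with `|g| ≤ B` a.e. and `W f = ∫ g·f dμ` for every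
`f ∈ L¹(μ)`.  This is the easy half of the duality `(L¹)* = L^∞` (folklore; e.g. W. Rudin, *Real and Complex Analysis*, Thm. 6.16;
Dunford–Schwartz IV.8.5), which Mathlib does not provide; we prove it through the signed Radon–Nikodym theorem, which Mathlib does.

ROUTE.  `ν(A) := W(𝟙_A)` (`𝟙_A = indicatorConstLp 1 A 1 ∈ L¹`) is a signed measure: countable additivity is the `L¹`-convergence of the
indicators of the partial unions (`tendsto_indicatorConstLp_set`) pushed through the continuous `W`; `ν ≪ μ`; the signed Radon–Nikodym
theorem (`SignedMeasure.absolutelyContinuous_iff_withDensityᵥ_rnDeriv_eq`) gives an integrable `g` with `ν(A) = ∫_A g`; the bound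
`|∫_A g| ≤ B μ(A)` for all `A` gives `|g| ≤ B` a.e. (`ae_nonneg_of_forall_setIntegral_nonneg` applied to `B ± g`); finally
`f ↦ W f` and `f ↦ ∫ g f` are continuous on `L¹` and agree on indicator simple functions, hence everywhere (`Lp.simpleFunc.denseRange`).

Consumers: kernel-extraction steps («an off-diagonal density bound `|T F| ≤ B‖F‖₁` yields a bounded two-point kernel»), e.g. the soft half
of crux ⟨stmt-QuantumFields-23036⟩ `F4SubCurvatureDoor.SubCurvatureKernel`.  Seat `ym-line-sfw-p2` g76 (cell ym-idea-1, free hands).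
-/

noncomputable section

open MeasureTheory Filter Topology Set
open scoped ENNReal

namespace Literature.MeasureTheory.Function

variable {α : Type*} [MeasurableSpace α] {μ : Measure α}

/-! ## Indicators in `L¹`: finite additivity and countable additivity -/

/-- Partial sums of the `L¹` indicators of a pairwise disjoint measurable family are the indicator of the accumulated union (finite additivity of
`A ↦ χ_A` in `L¹`; Rudin, proof of Thm. 6.16, first display). [cite: Rudin1987, Thm. 6.16 (proof)] -/
theorem sum_indicatorConstLp_eq_accumulate [IsFiniteMeasure μ] (f : ℕ → Set α) (hf : ∀ i, MeasurableSet (f i))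
    (hdisj : Pairwise (Function.onFun Disjoint f)) (c : ℝ) (n : ℕ) :
    ∑ i ∈ Finset.range (n + 1), indicatorConstLp 1 (hf i) (measure_ne_top μ _) c =
      indicatorConstLp 1 (MeasurableSet.iUnion fun i => MeasurableSet.iUnion fun _ => hf i : MeasurableSet (Set.accumulate f n))
        (measure_ne_top μ _) c := by
  induction n with
  | zero =>
    rw [Finset.sum_range_one]
    congr 1
    exact (Set.accumulate_zero_nat f).symm
  | succ n ih =>
    rw [Finset.sum_range_succ, ih]
    have hdis : Disjoint (Set.accumulate f n) (f (n + 1)) := by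
      rw [Set.disjoint_left]
      intro x hx hx'
      obtain ⟨i, hi, hxi⟩ := Set.mem_accumulate.mp hx
      exact Set.disjoint_left.mp (hdisj (show i ≠ n + 1 by omega)) hxi hx'
    have h := indicatorConstLp_disjoint_union (p := (1 : ℝ≥0∞)) (μ := μ)
      (MeasurableSet.iUnion fun i => MeasurableSet.iUnion fun _ => hf i : MeasurableSet (Set.accumulate f n)) (hf (n + 1))
      (measure_ne_top μ _) (measure_ne_top μ _) hdis c
    rw [← h]
    congr 1
    exact (Set.accumulate_succ f n).symm

/-- **Countable additivity of indicators in `L¹`** (finite measure): for a pairwise disjoint measurable family, the `L¹` indicators sum to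
the indicator of the union («countable additivity of `λ(E) = Φ(χ_E)` follows from the continuity of `Φ`», Rudin, proof of Thm. 6.16).
[cite: Rudin1987, Thm. 6.16 (proof)] -/
theorem hasSum_indicatorConstLp [IsFiniteMeasure μ] (f : ℕ → Set α) (hf : ∀ i, MeasurableSet (f i))
    (hdisj : Pairwise (Function.onFun Disjoint f)) (c : ℝ) :
    HasSum (fun i => indicatorConstLp 1 (hf i) (measure_ne_top μ _) c)
      (indicatorConstLp 1 (MeasurableSet.iUnion hf) (measure_ne_top μ _) c) := by
  -- the partial unions converge to the union in measure, hence the indicators converge in `L¹`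
  have hacc : ∀ n, MeasurableSet (Set.accumulate f n) := fun n =>
    MeasurableSet.iUnion fun i => MeasurableSet.iUnion fun _ => hf i
  have htend : Tendsto (fun n => indicatorConstLp 1 (hacc n) (measure_ne_top μ _) c) atTop
      (𝓝 (indicatorConstLp 1 (MeasurableSet.iUnion hf) (measure_ne_top μ _) c)) := by
    refine tendsto_indicatorConstLp_set (hμt := fun n => measure_ne_top μ _) ENNReal.one_ne_top ?_
    have hsub : ∀ n, Set.accumulate f n ⊆ ⋃ i, f i := fun n => Set.accumulate_subset_iUnion n
    have hdiff : ∀ n, symmDiff (Set.accumulate f n) (⋃ i, f i) = (⋃ i, f i) \ Set.accumulate f n := fun n => by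
      rw [Set.symmDiff_def, Set.sdiff_eq_empty.mpr (hsub n), Set.empty_union]
    simp_rw [hdiff]
    have hm : ∀ n, μ ((⋃ i, f i) \ Set.accumulate f n) = μ (⋃ i, f i) - μ (Set.accumulate f n) := fun n =>
      measure_sdiff (hsub n) (hacc n).nullMeasurableSet (measure_ne_top μ _)
    simp_rw [hm]
    have h1 := tendsto_measure_iUnion_accumulate (μ := μ) (f := f)
    have h2 : Tendsto (fun n => μ (⋃ i, f i) - μ (Set.accumulate f n)) atTop (𝓝 (μ (⋃ i, f i) - μ (⋃ i, f i))) :=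
      ENNReal.Tendsto.sub tendsto_const_nhds h1 (Or.inl (measure_ne_top μ _))
    rwa [tsub_self] at h2
  -- the norms are summable (bounded partial sums), so the series converges to the same limit
  have hnorm : ∀ i, ‖indicatorConstLp 1 (hf i) (measure_ne_top μ _) c‖ = ‖c‖ * (μ (f i)).toReal := by
    intro i
    rw [norm_indicatorConstLp one_ne_zero ENNReal.one_ne_top, ENNReal.toReal_one, div_one, Real.rpow_one,
      measureReal_def]
  have hsumm : Summable fun i => ‖indicatorConstLp 1 (hf i) (measure_ne_top μ _) c‖ := by
    simp_rw [hnorm]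
    refine Summable.mul_left _ (ENNReal.summable_toReal ?_)
    rw [← measure_iUnion hdisj hf]
    exact measure_ne_top μ _
  have hS : Summable fun i => indicatorConstLp 1 (hf i) (measure_ne_top μ _) c := Summable.of_norm hsumm
  have ht2 : Tendsto (fun n => ∑ i ∈ Finset.range (n + 1), indicatorConstLp 1 (hf i) (measure_ne_top μ _) c) atTop
      (𝓝 (∑' i, indicatorConstLp 1 (hf i) (measure_ne_top μ _) c)) :=
    hS.hasSum.tendsto_sum_nat.comp (tendsto_add_atTop_nat 1)
  have ht1 : Tendsto (fun n => ∑ i ∈ Finset.range (n + 1), indicatorConstLp 1 (hf i) (measure_ne_top μ _) c) atTop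
      (𝓝 (indicatorConstLp 1 (MeasurableSet.iUnion hf) (measure_ne_top μ _) c)) := by
    simp_rw [sum_indicatorConstLp_eq_accumulate f hf hdisj c]
    exact htend
  rw [tendsto_nhds_unique ht1 ht2]
  exact hS.hasSum

/-! ## The signed measure `A ↦ W(𝟙_A)` and its density -/

/-- **An `L¹`-bounded functional has an essentially bounded density** (finite measure).  For a continuous linear functional `W` on
`L¹(μ;ℝ)` with `|W f| ≤ B‖f‖`, there is an integrable `g` with `|g| ≤ B` a.e. such that `W f = ∫ g·f dμ` for all `f ∈ L¹(μ)`.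
This is the case `p = 1`, `μ(X) < ∞` of Rudin's Theorem 6.16 («`(L^p)* = L^q`»: every bounded linear functional `Φ` on `L¹(μ)` is
`Φ f = ∫ f g dμ` with `g ∈ L^∞`, `‖g‖_∞ = ‖Φ‖`), in the form `|g| ≤ B` a.e. for any bound `B` of `Φ`. [cite: Rudin1987, Thm. 6.16] -/
theorem exists_bounded_density_of_l1_bounded [IsFiniteMeasure μ] (W : (α →₁[μ] ℝ) →L[ℝ] ℝ) (B : ℝ)
    (hW : ∀ f : α →₁[μ] ℝ, |W f| ≤ B * ‖f‖) :
    ∃ g : α → ℝ, Integrable g μ ∧ (∀ᵐ x ∂μ, |g x| ≤ B) ∧ ∀ f : α →₁[μ] ℝ, W f = ∫ x, g x * f x ∂μ := by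
  classical
  -- the indicator of a measurable set as an element of `L¹`
  set ind : ∀ s : Set α, MeasurableSet s → (α →₁[μ] ℝ) := fun s hs => indicatorConstLp 1 hs (measure_ne_top μ s) (1 : ℝ) with hind
  have hind_norm : ∀ (s : Set α) (hs : MeasurableSet s), ‖ind s hs‖ = (μ s).toReal := by
    intro s hs
    rw [hind, norm_indicatorConstLp one_ne_zero ENNReal.one_ne_top, ENNReal.toReal_one, div_one, Real.rpow_one, norm_one, one_mul,
      measureReal_def]
  -- `ν(A) = W(𝟙_A)` is a signed measure
  let ν : SignedMeasure α :=
    { measureOf' := fun s => if hs : MeasurableSet s then W (ind s hs) else 0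
      empty' := by
        simp only [MeasurableSet.empty, dif_pos]
        rw [hind]
        simp only [indicatorConstLp_empty, map_zero]
      not_measurable' := fun s hs => by simp only [hs, dif_neg, not_false_eq_true]
      m_iUnion' := by
        intro f hf hdisj
        simp only [hf, MeasurableSet.iUnion hf, dif_pos]
        exact (hasSum_indicatorConstLp f hf hdisj 1).mapL W }
  have hν_apply : ∀ (s : Set α) (hs : MeasurableSet s), ν s = W (ind s hs) := by
    intro s hs
    show (if hs : MeasurableSet s then W (ind s hs) else 0) = W (ind s hs)
    rw [dif_pos hs]
  -- `ν ≪ μ`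
  have hν_ac : ν ≪ᵥ μ.toENNRealVectorMeasure := by
    refine VectorMeasure.AbsolutelyContinuous.mk fun s hs hs0 => ?_
    rw [Measure.toENNRealVectorMeasure_apply_measurable hs] at hs0
    rw [hν_apply s hs]
    have h0 : ind s hs = 0 := by
      rw [← norm_eq_zero, hind_norm, hs0, ENNReal.toReal_zero]
    rw [h0, map_zero]
  -- Radon–Nikodym density
  set g : α → ℝ := ν.rnDeriv μ with hg
  have hg_int : Integrable g μ := SignedMeasure.integrable_rnDeriv ν μ
  have hνg : μ.withDensityᵥ g = ν := (SignedMeasure.absolutelyContinuous_iff_withDensityᵥ_rnDeriv_eq ν μ).mp hν_ac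
  have hset : ∀ (s : Set α) (hs : MeasurableSet s), ∫ x in s, g x ∂μ = W (ind s hs) := by
    intro s hs
    rw [← hν_apply s hs, ← hνg, withDensityᵥ_apply hg_int hs]
  -- the bound `|g| ≤ B` a.e.
  have hbound : ∀ᵐ x ∂μ, |g x| ≤ B := by
    have hup : 0 ≤ᵐ[μ] fun x => B - g x := by
      refine ae_nonneg_of_forall_setIntegral_nonneg ((integrable_const B).sub hg_int) fun s hs _ => ?_
      rw [integral_sub (integrable_const B).integrableOn hg_int.integrableOn, setIntegral_const, smul_eq_mul, hset s hs]
      have h := (abs_le.mp (hW (ind s hs))).2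
      rw [hind_norm s hs, ← measureReal_def] at h
      linarith
    have hdown : 0 ≤ᵐ[μ] fun x => B + g x := by
      refine ae_nonneg_of_forall_setIntegral_nonneg ((integrable_const B).add hg_int) fun s hs _ => ?_
      rw [integral_add (integrable_const B).integrableOn hg_int.integrableOn, setIntegral_const, smul_eq_mul, hset s hs]
      have h := (abs_le.mp (hW (ind s hs))).1
      rw [hind_norm s hs, ← measureReal_def] at h
      linarith
    filter_upwards [hup, hdown] with x h1 h2
    simp only [Pi.zero_apply] at h1 h2
    exact abs_le.mpr ⟨by linarith, by linarith⟩
  refine ⟨g, hg_int, hbound, ?_⟩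
  -- a nonnegative bound
  set B' : ℝ := max B 0 with hB'
  have hB'0 : 0 ≤ B' := le_max_right _ _
  have hbound' : ∀ᵐ x ∂μ, |g x| ≤ B' := by
    filter_upwards [hbound] with x hx using hx.trans (le_max_left _ _)
  -- the two continuous functionals `W` and `f ↦ ∫ g f` agree on simple functions, hence everywhere
  have hgf_int : ∀ f : α →₁[μ] ℝ, Integrable (fun x => g x * f x) μ := by
    intro f
    refine Integrable.mono' ((L1.integrable_coeFn f).norm.const_mul B')
      (hg_int.aestronglyMeasurable.mul (L1.integrable_coeFn f).aestronglyMeasurable) ?_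
    filter_upwards [hbound'] with x hx
    rw [norm_mul, Real.norm_eq_abs]
    exact mul_le_mul_of_nonneg_right hx (norm_nonneg _)
  have hcont : Continuous fun f : α →₁[μ] ℝ => ∫ x, g x * f x ∂μ := by
    refine (LipschitzWith.of_dist_le_mul (K := ⟨B', hB'0⟩) fun f f' => ?_).continuous
    rw [Real.dist_eq, dist_eq_norm, ← integral_sub (hgf_int f) (hgf_int f')]
    have hsub : (fun x => g x * f x - g x * f' x) =ᵐ[μ] fun x => g x * (f - f' : α →₁[μ] ℝ) x := by
      filter_upwards [Lp.coeFn_sub f f'] with x hx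
      rw [hx, Pi.sub_apply, mul_sub]
    rw [integral_congr_ae hsub]
    calc |∫ x, g x * (f - f' : α →₁[μ] ℝ) x ∂μ| ≤ ∫ x, |g x * (f - f' : α →₁[μ] ℝ) x| ∂μ := abs_integral_le_integral_abs
      _ ≤ ∫ x, B' * ‖(f - f' : α →₁[μ] ℝ) x‖ ∂μ := by
          refine integral_mono_ae (hgf_int _).abs ((L1.integrable_coeFn _).norm.const_mul B') ?_
          filter_upwards [hbound'] with x hx
          rw [abs_mul, Real.norm_eq_abs]
          exact mul_le_mul_of_nonneg_right hx (abs_nonneg _)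
      _ = B' * ‖f - f'‖ := by rw [integral_const_mul, L1.norm_eq_integral_norm]
      _ = (⟨B', hB'0⟩ : NNReal) * ‖f - f'‖ := rfl
  have hdense := Lp.simpleFunc.denseRange (E := ℝ) (p := (1 : ℝ≥0∞)) (μ := μ) ENNReal.one_ne_top
  have heq := hdense.equalizer W.continuous hcont ?_
  · intro f
    exact congrFun heq f
  funext φ
  simp only [Function.comp_apply]
  induction φ using Lp.simpleFunc.induction one_ne_zero ENNReal.one_ne_top with
  | @indicatorConst c s hs hμs =>
    rw [Lp.simpleFunc.coe_indicatorConst]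
    -- `𝟙_s · c = c • 𝟙_s`
    have hsmul : indicatorConstLp 1 hs hμs.ne c = c • ind _ hs := by
      refine Lp.ext_iff.mpr ?_  -- a.e. equality of representatives
      filter_upwards [indicatorConstLp_coeFn (p := (1 : ℝ≥0∞)) (hs := hs) (hμs := hμs.ne) (c := c),
        Lp.coeFn_smul c (ind _ hs), indicatorConstLp_coeFn (p := (1 : ℝ≥0∞)) (hs := hs) (hμs := measure_ne_top μ _) (c := (1 : ℝ))]
        with x h1 h2 h3
      rw [h1, h2, Pi.smul_apply, hind] at *
      rw [h3]
      by_cases hx : x ∈ s <;> simp [hx]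
    rw [hsmul, map_smul, smul_eq_mul, ← hset _ hs]
    have hae : (fun x => g x * (c • ind _ hs : α →₁[μ] ℝ) x) =ᵐ[μ] fun x => c * s.indicator g x := by
      filter_upwards [Lp.coeFn_smul c (ind _ hs),
        indicatorConstLp_coeFn (p := (1 : ℝ≥0∞)) (hs := hs) (hμs := measure_ne_top μ _) (c := (1 : ℝ))] with x h1 h2
      rw [h1, Pi.smul_apply, hind] at *
      rw [h2]
      by_cases hx : x ∈ s <;> simp [hx, mul_comm]
    rw [integral_congr_ae hae, integral_const_mul, integral_indicator hs]
  | @add φ₁ φ₂ hf hf' hdis hPf hPf' =>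
    rw [AddSubgroup.coe_add, map_add, hPf, hPf', ← integral_add (hgf_int _) (hgf_int _)]
    refine integral_congr_ae ?_
    filter_upwards [Lp.coeFn_add (SimpleFunc.toLp φ₁ hf : α →₁[μ] ℝ) (SimpleFunc.toLp φ₂ hf' : α →₁[μ] ℝ)] with x hx
    rw [← mul_add, ← Pi.add_apply, ← hx]

end Literature.MeasureTheory.Function

end
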